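import Summits.Ventures.HodgeRepro2.T5CMRealBaseChange
import Summits.Ventures.HodgeRepro2.T5CMInfinitePlaces

/-!
# Tier-5 support (seat p3, cell pub-hodge-repro2) — the completion of a CM field at an
archimedean place IS the base change: `K⁺_v ⊗[K⁺] K ≃ₐ[K⁺_v] K_w`

Behind route/T4-B1-p3.md v7 (sub-claim B1, FINAL) l. 32 «at a place v it is c ⊗ 1 on
F_v = F ⊗_{F⁺} F⁺_v» and l. 33 «at a real place τ of F⁺, F ⊗_{F⁺,τ} ℝ ≅ ℂ (n_τ = 2)», and the
«completions» item of route/T5-N2-route-3.md §N2.9.2 (l. 63) at the ARCHIMEDEAN places, in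
Mathlib's own completion vocabulary (`InfinitePlace.Completion`, the scoped
`NumberField.LiesOver` algebra `v.Completion → w.Completion`): for `NumberField.IsCMField K`,
`K⁺ = maximalRealSubfield K`, an infinite place `v` of `K⁺` and a place `w` of `K` over it,

* `completionBaseChangeHom K v w : v.Completion ⊗[K⁺] K →ₐ[v.Completion] w.Completion`,
  `c ⊗ x ↦ c • x` (Mathlib's `AlgHom.liftEquiv` applied to `K → w.Completion`);
* it is BIJECTIVE (`completionBaseChangeEquiv K v w`): injective because the source is a FIELD —
  it is isomorphic to `ℝ ⊗[K⁺] K ≅ ℂ` through `v.Completion ≃+* ℝ` (file 105) and file 102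
  (`nonempty_ringEquiv_complex`, `isField_tensor`), and a ring hom out of a field is injective;
  surjective by the dimension count `[v.Completion ⊗[K⁺] K : v.Completion] = [K : K⁺] = 2 =
  [w.Completion : v.Completion]` (`Module.finrank_baseChange`, file 105's
  `finrank_completion_eq_two`).

So at the archimedean places the «completions» identification `E ⊗_F F_v = E_v` is a theorem of
the tree (the non-archimedean one, `E ⊗_F F_v = ∏_{w∣v} E_w`, stays the printed input — Kudla's
splitting — as recorded in LEAN-ANNEX-p3.md §46). Nothing here is a display; Mathlib + own files
102 / 105. Header declaration (README §8(d)): uses an L-value-free non-vanishing device: NO.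
-/

open NumberField NumberField.InfinitePlace Module
open scoped NumberField.LiesOver TensorProduct

namespace Summit.Ventures.HodgeRepro2.T5CMCompletionBaseChange

open T5CMRealBaseChange T5CMInfinitePlaces

variable (K : Type*) [Field K] [NumberField K] [IsCMField K]
variable (v : InfinitePlace (maximalRealSubfield K)) (w : InfinitePlace K) [w.1.LiesOver v.1]

/-! ## 1. The base-change map -/

omit [NumberField K] [IsCMField K] in
/-- `K → w.Completion` as a `K⁺`-algebra hom. -/
noncomputable def toCompletionAlgHom : K →ₐ[maximalRealSubfield K] w.Completion :=
  IsScalarTower.toAlgHom (maximalRealSubfield K) K w.Completion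

omit [NumberField K] [IsCMField K] in
/-- `toCompletionAlgHom K w x = (x : w.Completion)`. -/
@[simp] theorem toCompletionAlgHom_apply (x : K) :
    toCompletionAlgHom K w x = algebraMap K w.Completion x := rfl

omit [NumberField K] [IsCMField K] in
/-- The base-change map `v.Completion ⊗[K⁺] K →ₐ[v.Completion] w.Completion`, `c ⊗ x ↦ c • x`. -/
noncomputable def completionBaseChangeHom :
    v.Completion ⊗[maximalRealSubfield K] K →ₐ[v.Completion] w.Completion :=
  AlgHom.liftEquiv (maximalRealSubfield K) v.Completion K w.Completion (toCompletionAlgHom K w)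

omit [NumberField K] [IsCMField K] in
/-- `completionBaseChangeHom K v w (c ⊗ x) = c • x`. -/
@[simp] theorem completionBaseChangeHom_tmul (c : v.Completion) (x : K) :
    completionBaseChangeHom K v w (c ⊗ₜ x) = c • algebraMap K w.Completion x :=
  AlgHom.liftEquiv_tmul (toCompletionAlgHom K w) c x

omit [NumberField K] [IsCMField K] in
/-- `completionBaseChangeHom K v w (1 ⊗ x) = x`. -/
theorem completionBaseChangeHom_one_tmul (x : K) :
    completionBaseChangeHom K v w (1 ⊗ₜ x) = algebraMap K w.Completion x := by
  rw [completionBaseChangeHom_tmul, one_smul]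

/-! ## 2. The source is a field: `v.Completion ⊗[K⁺] K ≅ ℝ ⊗[K⁺] K ≅ ℂ` -/

/-- Through `v.Completion ≃+* ℝ` (file 105) and `ℝ ⊗[K⁺] K ≃ₐ[ℝ] ℂ` (file 102),
`v.Completion ⊗[K⁺] K ≃+* ℂ`. -/
theorem nonempty_ringEquiv_complex :
    Nonempty (v.Completion ⊗[maximalRealSubfield K] K ≃+* ℂ) := by
  letI : Algebra (maximalRealSubfield K) ℝ :=
    ((realCompletionEquiv K v).toRingHom.comp
      (algebraMap (maximalRealSubfield K) v.Completion)).toAlgebra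
  letI : Algebra (maximalRealSubfield K) ℂ :=
    (Complex.ofRealHom.comp (algebraMap (maximalRealSubfield K) ℝ)).toAlgebra
  haveI : IsScalarTower (maximalRealSubfield K) ℝ ℂ :=
    IsScalarTower.of_algebraMap_eq fun _ => rfl
  let e₀ : v.Completion ≃ₐ[maximalRealSubfield K] ℝ :=
    AlgEquiv.ofRingEquiv (f := realCompletionEquiv K v) fun _ => rfl
  let e₁ : v.Completion ⊗[maximalRealSubfield K] K ≃ₐ[maximalRealSubfield K]
      ℝ ⊗[maximalRealSubfield K] K :=
    Algebra.TensorProduct.congr e₀ AlgEquiv.refl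
  exact ⟨e₁.toRingEquiv.trans (baseChangeEquiv K (liftAlgHom K)).toRingEquiv⟩

/-- `v.Completion ⊗[K⁺] K` is a field. -/
theorem isField_tensor : IsField (v.Completion ⊗[maximalRealSubfield K] K) := by
  obtain ⟨e⟩ := nonempty_ringEquiv_complex K v
  exact MulEquiv.isField (Field.toIsField ℂ) e.toMulEquiv

/-! ## 3. Bijectivity -/

/-- Injective: a ring hom out of (a ring isomorphic to) the field `ℂ`. -/
theorem completionBaseChangeHom_injective :
    Function.Injective (completionBaseChangeHom K v w) := by
  obtain ⟨e⟩ := nonempty_ringEquiv_complex K v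
  have h : Function.Injective
      ((completionBaseChangeHom K v w : _ →+* w.Completion).comp e.symm.toRingHom) :=
    RingHom.injective _
  intro x y hxy
  apply e.injective
  apply h
  simp [hxy]

/-- `[v.Completion ⊗[K⁺] K : v.Completion] = [K : K⁺] = 2`. -/
theorem finrank_tensor_eq_two :
    finrank v.Completion (v.Completion ⊗[maximalRealSubfield K] K) = 2 := by
  rw [Module.finrank_baseChange, Algebra.IsQuadraticExtension.finrank_eq_two (maximalRealSubfield K) K]

/-- `w.Completion` is finite-dimensional over `v.Completion` (of dimension `2`, file 105). -/
theorem finiteDimensional_completion : FiniteDimensional v.Completion w.Completion :=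
  FiniteDimensional.of_finrank_pos (by rw [finrank_completion_eq_two K v w]; exact two_pos)

/-- Bijective, by injectivity and the dimension count `2 = 2`. -/
theorem completionBaseChangeHom_bijective :
    Function.Bijective (completionBaseChangeHom K v w) := by
  haveI := finiteDimensional_completion K v w
  refine ⟨completionBaseChangeHom_injective K v w, ?_⟩
  have h : finrank v.Completion (v.Completion ⊗[maximalRealSubfield K] K) =
      finrank v.Completion w.Completion := by
    rw [finrank_tensor_eq_two, finrank_completion_eq_two K v w]
  exact (LinearMap.injective_iff_surjective_of_finrank_eq_finrank h
    (f := (completionBaseChangeHom K v w).toLinearMap)).mp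
    (completionBaseChangeHom_injective K v w)

/-- THE IDENTIFICATION at an archimedean place: `K⁺_v ⊗[K⁺] K ≃ₐ[K⁺_v] K_w` — B1 l. 32 / l. 33
and the «completions» item of §N2.9.2 in Mathlib's completion vocabulary. -/
noncomputable def completionBaseChangeEquiv :
    v.Completion ⊗[maximalRealSubfield K] K ≃ₐ[v.Completion] w.Completion :=
  AlgEquiv.ofBijective (completionBaseChangeHom K v w) (completionBaseChangeHom_bijective K v w)

/-- `completionBaseChangeEquiv K v w (c ⊗ x) = c • x`. -/
theorem completionBaseChangeEquiv_tmul (c : v.Completion) (x : K) :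
    completionBaseChangeEquiv K v w (c ⊗ₜ x) = c • algebraMap K w.Completion x :=
  completionBaseChangeHom_tmul K v w c x

/-- The same for THE place above `v` (file 105's `placeOver K v`). -/
noncomputable def completionBaseChangeEquivPlaceOver :
    v.Completion ⊗[maximalRealSubfield K] K ≃ₐ[v.Completion] (placeOver K v).Completion :=
  completionBaseChangeEquiv K v (placeOver K v)

end Summit.Ventures.HodgeRepro2.T5CMCompletionBaseChange
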